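/-
Copyright (c) 2026. Released under Apache 2.0 license.
-/
import Literature.NumberTheory.Automorphic.UnboundedDenominatorsInvariantHom
import Mathlib.GroupTheory.FiniteAbelian.Basic
import Mathlib.GroupTheory.Schreier
import HarnessLib

/-!
# `[SL₂(ℤ), Γ(N)]` has finite index; the invariant form of CDT Cor. 4.5.3 ⟺ its congruence property

Let `K_N = [SL₂(ℤ), Γ(N)]` (`N ≥ 1`).  The quotient `Γ(N)/K_N` carries the UNIVERSAL `SL₂(ℤ)`-invariant
homomorphism out of `Γ(N)` (realised here inside `Γ(N)ᵃᵇ` modulo the image of `K_N`).  From the transfer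
exponent bound of `UnboundedDenominatorsInvariantHom` (`θ(x)^{12·[SL₂(ℤ):Γ(N)]} = 1` for every invariant `θ`):

* `pow_mem_commutator_top_Gamma` — `x^{12·[SL₂(ℤ):Γ(N)]} ∈ K_N` for every `x ∈ Γ(N)`;
* `finiteIndex_commutator_top_Gamma` — **`K_N` has finite index in `SL₂(ℤ)`** (`Γ(N)/K_N` is a finitely
  generated abelian torsion group; its order is `12/gcd(N,12) · |M(SL₂(ℤ/N))|` by [Beyl1986], not proved here);
* `commutator_congruence_of_cor453_invariant_form` — conversely to
  `cor453_invariant_form_of_commutator_congruence`: the invariant form of [CalegariDimitrovTang2025, Cor. 4.5.3]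
  (for finite abelian targets) IMPLIES that every `K_N` contains a principal congruence subgroup.  So the input
  `hcor` of the tree's CDT assembly is EQUIVALENT to the classical statement «`[SL₂(ℤ), Γ(N)]` is a
  congruence subgroup for all `N ≥ 1`» [Beyl1986].
-/

open scoped MatrixGroups commutatorElement

namespace Literature.NumberTheory.Automorphic

namespace UnboundedDenominators

open CongruenceSubgroup Matrix.SpecialLinearGroup ModularGroup

/-- The commutator subgroup of the abstract group `Γ(N)` lies in `[SL₂(ℤ), Γ(N)]`.
[cite: CalegariDimitrovTang2025, Corollary 4.5.3] -/
theorem coe_mem_commutator_top_Gamma_of_mem_commutator {N : ℕ} {c : Gamma N}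
    (hc : c ∈ commutator (Gamma N)) : (c : SL(2, ℤ)) ∈ ⁅(⊤ : Subgroup SL(2, ℤ)), Gamma N⁆ := by
  have h1 : (c : SL(2, ℤ)) ∈ (commutator (Gamma N)).map (Gamma N).subtype := ⟨c, hc, rfl⟩
  rw [commutator_def, Subgroup.map_commutator, ← MonoidHom.range_eq_map, Subgroup.range_subtype] at h1
  exact Subgroup.commutator_mono le_top le_rfl h1

/-- **The universal invariant homomorphism.** With `B` the image of `K_N = [SL₂(ℤ), Γ(N)]` in `Γ(N)ᵃᵇ`,
the map `θ₀ : Γ(N) → Γ(N)ᵃᵇ/B` is `SL₂(ℤ)`-conjugation invariant and its kernel is exactly `K_N`.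
[cite: CalegariDimitrovTang2025, Corollary 4.5.3] -/
theorem exists_universal_invariant_hom (N : ℕ) :
    ∃ B : Subgroup (Abelianization (Gamma N)),
      (∀ (g x : SL(2, ℤ)) (hx : x ∈ Gamma N) (hgx : g * x * g⁻¹ ∈ Gamma N),
        ((QuotientGroup.mk' B).comp Abelianization.of) ⟨g * x * g⁻¹, hgx⟩ =
          ((QuotientGroup.mk' B).comp Abelianization.of) ⟨x, hx⟩) ∧
      (∀ x : Gamma N, ((QuotientGroup.mk' B).comp Abelianization.of) x = 1 ↔
        (x : SL(2, ℤ)) ∈ ⁅(⊤ : Subgroup SL(2, ℤ)), Gamma N⁆) := by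
  let K' : Subgroup (Gamma N) := (⁅(⊤ : Subgroup SL(2, ℤ)), Gamma N⁆).subgroupOf (Gamma N)
  have hK' : ∀ y : Gamma N, y ∈ K' ↔ (y : SL(2, ℤ)) ∈ ⁅(⊤ : Subgroup SL(2, ℤ)), Gamma N⁆ :=
    fun y ↦ Subgroup.mem_subgroupOf
  refine ⟨K'.map Abelianization.of, ?_, ?_⟩
  · intro g x hx hgx
    rw [MonoidHom.comp_apply, MonoidHom.comp_apply, QuotientGroup.mk'_eq_mk']
    refine ⟨Abelianization.of ((⟨g * x * g⁻¹, hgx⟩ : Gamma N)⁻¹ * ⟨x, hx⟩), ?_, ?_⟩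
    · refine Subgroup.mem_map_of_mem _ ((hK' _).mpr ?_)
      have h : (((⟨g * x * g⁻¹, hgx⟩ : Gamma N)⁻¹ * ⟨x, hx⟩ : Gamma N) : SL(2, ℤ)) = ⁅g, x⁻¹⁆ := by
        simp [commutatorElement_def, mul_assoc]
      rw [h]
      exact Subgroup.commutator_mem_commutator (Subgroup.mem_top g) (inv_mem hx)
    · rw [← map_mul, mul_inv_cancel_left]
  · intro x
    rw [MonoidHom.comp_apply, QuotientGroup.mk'_apply, QuotientGroup.eq_one_iff, Subgroup.mem_map]
    constructor
    · rintro ⟨y, hy, hyx⟩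
      have hy' := (hK' y).mp hy
      have h1 : y⁻¹ * x ∈ commutator (Gamma N) := by
        rw [← Abelianization.ker_of, MonoidHom.mem_ker, map_mul, map_inv, hyx, inv_mul_cancel]
      have h2 := coe_mem_commutator_top_Gamma_of_mem_commutator h1
      have h3 : (x : SL(2, ℤ)) = y * ((y⁻¹ * x : Gamma N) : SL(2, ℤ)) := by simp
      rw [h3]
      exact mul_mem hy' h2
    · intro hx
      exact ⟨x, (hK' x).mpr hx, rfl⟩

/-- **`x^{12·[SL₂(ℤ):Γ(N)]} ∈ [SL₂(ℤ), Γ(N)]` for every `x ∈ Γ(N)`** (`N ≥ 1`): the quotient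
`Γ(N)/[SL₂(ℤ), Γ(N)]` has exponent dividing `12·[SL₂(ℤ):Γ(N)]` (transfer).
[cite: CalegariDimitrovTang2025, Corollary 4.5.3] -/
theorem pow_mem_commutator_top_Gamma {N : ℕ} [NeZero N] {x : SL(2, ℤ)} (hx : x ∈ Gamma N) :
    x ^ (12 * (Gamma N).index) ∈ ⁅(⊤ : Subgroup SL(2, ℤ)), Gamma N⁆ := by
  obtain ⟨B, hinv, hker⟩ := exists_universal_invariant_hom N
  have h := pow_index_eq_one_of_invariant _ hinv ⟨x, hx⟩
  rw [← map_pow, hker] at h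
  simpa using h

/-- **`[SL₂(ℤ), Γ(N)]` has finite index in `SL₂(ℤ)`** (`N ≥ 1`): `Γ(N)/[SL₂(ℤ), Γ(N)]` is a finitely
generated (Schreier) abelian group of finite exponent. [cite: Beyl1986, Theorem] -/
theorem finiteIndex_commutator_top_Gamma (N : ℕ) [NeZero N] :
    (⁅(⊤ : Subgroup SL(2, ℤ)), Gamma N⁆).FiniteIndex := by
  classical
  let K' : Subgroup (Gamma N) := (⁅(⊤ : Subgroup SL(2, ℤ)), Gamma N⁆).subgroupOf (Gamma N)
  obtain ⟨B, hinv, hθ₀⟩ := exists_universal_invariant_hom N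
  let θ₀ : Gamma N →* Abelianization (Gamma N) ⧸ B := (QuotientGroup.mk' B).comp Abelianization.of
  have hsurj : Function.Surjective θ₀ :=
    (QuotientGroup.mk'_surjective B).comp QuotientGroup.mk_surjective
  -- finitely generated
  haveI : Group.FG SL(2, ℤ) :=
    (Group.fg_iff).mpr ⟨{S, T}, SpecialLinearGroup.SL2Z_generators, Set.toFinite _⟩
  haveI : Group.FG (Gamma N) := Subgroup.fg_of_index_ne_zero _
  haveI : Group.FG (Abelianization (Gamma N)) :=
    Group.fg_of_surjective (f := Abelianization.of) QuotientGroup.mk_surjective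
  haveI : Group.FG (Abelianization (Gamma N) ⧸ B) := QuotientGroup.fg B
  -- torsion
  have htors : Monoid.IsTorsion (Abelianization (Gamma N) ⧸ B) := by
    intro q
    obtain ⟨x, rfl⟩ := hsurj q
    refine isOfFinOrder_iff_pow_eq_one.mpr ⟨12 * (Gamma N).index, ?_, ?_⟩
    · exact Nat.mul_pos (by norm_num) (Nat.pos_of_ne_zero Subgroup.FiniteIndex.index_ne_zero)
    · exact pow_index_eq_one_of_invariant θ₀ hinv x
  haveI : Finite (Abelianization (Gamma N) ⧸ B) := CommGroup.finite_of_fg_torsion _ htors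
  -- the index of `K'` in `Γ(N)` is the (finite) order of the quotient
  have hker : θ₀.ker = K' := by
    ext x
    rw [MonoidHom.mem_ker, hθ₀, Subgroup.mem_subgroupOf]
  have hK' : K'.index ≠ 0 := by
    rw [← hker, Subgroup.index_ker, MonoidHom.range_eq_top.mpr hsurj, Subgroup.card_top]
    exact Nat.card_pos.ne'
  refine ⟨?_⟩
  rw [← Subgroup.relIndex_mul_index
    (show ⁅(⊤ : Subgroup SL(2, ℤ)), Gamma N⁆ ≤ Gamma N from
      Subgroup.commutator_le_right _ _ (h := Gamma_normal N))]
  exact Nat.mul_ne_zero hK' Subgroup.FiniteIndex.index_ne_zero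

/-- **The invariant form of CDT Cor. 4.5.3 implies that `[SL₂(ℤ), Γ(N)]` is a congruence subgroup** (apply it
to the universal invariant homomorphism `Γ(N) → Γ(N)ᵃᵇ/(image of K_N)`, whose target is finite by
`finiteIndex_commutator_top_Gamma`).  Together with `cor453_invariant_form_of_commutator_congruence` the two
statements are equivalent. [cite: CalegariDimitrovTang2025, Corollary 4.5.3] -/
theorem commutator_congruence_of_cor453_invariant_form
    (hinv : ∀ (N : ℕ) (Q : Type) [CommGroup Q] [Finite Q] (θ : Gamma N →* Q),
      (∀ (g x : SL(2, ℤ)) (hx : x ∈ Gamma N) (hgx : g * x * g⁻¹ ∈ Gamma N),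
        θ ⟨g * x * g⁻¹, hgx⟩ = θ ⟨x, hx⟩) →
      ∃ M : ℕ, M ≠ 0 ∧ ∀ (x : SL(2, ℤ)) (hx : x ∈ Gamma N), x ∈ Gamma M → θ ⟨x, hx⟩ = 1)
    (N : ℕ) (hN : N ≠ 0) :
    ∃ M : ℕ, M ≠ 0 ∧ Gamma M ≤ ⁅(⊤ : Subgroup SL(2, ℤ)), Gamma N⁆ := by
  classical
  haveI : NeZero N := ⟨hN⟩
  let K' : Subgroup (Gamma N) := (⁅(⊤ : Subgroup SL(2, ℤ)), Gamma N⁆).subgroupOf (Gamma N)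
  obtain ⟨B, hinv0, hθ₀⟩ := exists_universal_invariant_hom N
  let θ₀ : Gamma N →* Abelianization (Gamma N) ⧸ B := (QuotientGroup.mk' B).comp Abelianization.of
  have hsurj : Function.Surjective θ₀ :=
    (QuotientGroup.mk'_surjective B).comp QuotientGroup.mk_surjective
  -- finiteness of the target, from the finite index of `K_N`
  haveI := finiteIndex_commutator_top_Gamma N
  have hK'fin : K'.index ≠ 0 := by
    intro h0
    have h := Subgroup.relIndex_mul_index
      (show ⁅(⊤ : Subgroup SL(2, ℤ)), Gamma N⁆ ≤ Gamma N from
        Subgroup.commutator_le_right _ _ (h := Gamma_normal N))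
    rw [Subgroup.relIndex, show (⁅(⊤ : Subgroup SL(2, ℤ)), Gamma N⁆.subgroupOf (Gamma N)).index = 0
      from h0, zero_mul] at h
    exact Subgroup.FiniteIndex.index_ne_zero h.symm
  have hker : θ₀.ker = K' := by
    ext x
    rw [MonoidHom.mem_ker, hθ₀, Subgroup.mem_subgroupOf]
  haveI : Finite (Abelianization (Gamma N) ⧸ B) := by
    have hcard : Nat.card (Abelianization (Gamma N) ⧸ B) = K'.index := by
      rw [← hker, Subgroup.index_ker, MonoidHom.range_eq_top.mpr hsurj, Subgroup.card_top]
    exact Nat.finite_of_card_ne_zero (hcard ▸ hK'fin)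
  obtain ⟨M, hM, hMker⟩ := hinv N (Abelianization (Gamma N) ⧸ B) θ₀ hinv0
  refine ⟨M * N, Nat.mul_ne_zero hM hN, fun x hx ↦ ?_⟩
  obtain ⟨h00, h01, h10, h11⟩ := Gamma_mem.mp hx
  have castN : ∀ a : ℤ, ((a : ZMod (M * N)).cast : ZMod N) = (a : ZMod N) := fun a ↦
    ZMod.cast_intCast (dvd_mul_left N M) a
  have castM : ∀ a : ℤ, ((a : ZMod (M * N)).cast : ZMod M) = (a : ZMod M) := fun a ↦
    ZMod.cast_intCast (dvd_mul_right M N) a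
  have hxN : x ∈ Gamma N := by
    rw [Gamma_mem]
    refine ⟨?_, ?_, ?_, ?_⟩
    · rw [← castN, h00, ZMod.cast_one (dvd_mul_left N M)]
    · rw [← castN, h01, ZMod.cast_zero]
    · rw [← castN, h10, ZMod.cast_zero]
    · rw [← castN, h11, ZMod.cast_one (dvd_mul_left N M)]
  have hxM : x ∈ Gamma M := by
    rw [Gamma_mem]
    refine ⟨?_, ?_, ?_, ?_⟩
    · rw [← castM, h00, ZMod.cast_one (dvd_mul_right M N)]
    · rw [← castM, h01, ZMod.cast_zero]
    · rw [← castM, h10, ZMod.cast_zero]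
    · rw [← castM, h11, ZMod.cast_one (dvd_mul_right M N)]
  exact (hθ₀ ⟨x, hxN⟩).mp (hMker x hxN hxM)

end UnboundedDenominators

end Literature.NumberTheory.Automorphic
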